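import Summits.RiemannHypothesis.RiemannHypothesis.Theorems.GroundBartaEvenWinsBeyondArchDeflationCertificate
import HarnessLib

/-!
# RiemannHypothesis / GroundBarta — rung 4 (`EvenWinsBeyondArch`, stmt-RiemannHypothesis-18807 / 18085):
# the deflated Temple L-side, XIII — the SIGMA CRITERION (diagonal-only PSD test; the residual Gram matrix is never formed)

Helper file (`--supports stmt-RiemannHypothesis-18807`), RH-free, Mathlib + landed tree files only, no definitions,
no named facts.  Prover B, speedrun unit `sr-gb-rung-b` (gen 4).

The PSD hypothesis of the deflated Temple bound (files IX–XI, `dt_weil{Even,Odd}GroundEnergy_ge_of_ritz /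
_of_checkR₁ / _of_certificates`) concerns the `k × k` matrix `M = N − R`, `N_ij = (β−λ)(A_ij − λ G_ij)` (energies and
`L²` Gram of the polynomial trial vectors — exact polynomial algebra plus one-dimensional enclosures, the "A-layer"),
`R_ij = ⟨r_i, r_j⟩`, `r_i = F_i − Σ_l W_il v_l` (Gram matrix of the window-image residuals — the "R-layer", whose
entries are integrals of products of TWO transcendental window images).  This file removes the cross Gram entries from the
certificate altogether: for any weights `θ_i > 0`, pointwise weighted Cauchy–Schwarz gives the operator inequality

  `Gram(r) ⪯ (Σ_i ‖r_i‖²/θ_i) · diag(θ)`      (`dt_gram_quadForm_le`),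

so `M ⪰ 0` follows from `k` NORM BOUNDS `s_i ≥ ‖r_i‖²₂` and the positive semidefiniteness of the A-layer matrix
`N − τ·diag(θ)`, `τ ≥ Σ_i s_i/θ_i` (`dt_psd_of_sigma`).  Consequences, in the shapes of files IX and XI:
`dt_weil{Even,Odd}GroundEnergy_ge_of_ritz_sigma` (C² profiles, abstract complement certificate) and
`dt_weil{Even,Odd}GroundEnergy_ge_of_checkR₁_sigma` (checked rank-one moment certificate, `b ≤ log 2`).

Why nothing is lost: in the basis of the true sector Ritz vectors `A` and `G` are diagonal, and with `θ_i = (β−λ)(ρ_i−λ)G_ii`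
the criterion reads `Σ_i σ_i²/((ρ_i − λ)G_ii) ≤ β − λ` — exactly the secular (Lehmann–Goerisch) value used in the
feasibility studies of this programme (`ε_ev(log 2)`: `6.7·10⁻¹³` at `β = 0.65`; first ladder cell, odd sector at `c = 18/25`,
`β = 1/3`: `λ* = 3.8·10⁻¹¹ > 10⁻¹¹` with a factor `5` to spare on `σ₁²`).  What is gained: the R-layer has to deliver `k`
numbers `s_i` with RELATIVE precision of order one (no `k²` cross integrals `∫ F_i F_j`, no absolute `10⁻¹³` budget), and since
`W` is free, any constant multiple of `v_i` inside `F_i` (the killing constant `M_c v_i`) may be computed with ANY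
approximation of `M_c` — the error is absorbed in `W_ii`.

References: N. J. Lehmann, Numer. Math. 5 (1963) 246–272 [Lehmann1963]; F. Goerisch, H. Haunhorst, Z. Angew. Math. Mech. 65 (1985) 129–135 [GoerischHaunhorst1985]
(eigenvalue bounds from `‖(A−ρ)v‖`); A. Weinstein, W. Stenger (1972) Ch. 5 §9.
-/

set_option linter.dupNamespace false

noncomputable section

open MeasureTheory Set Filter Finset
open scoped Topology ENNReal NNReal ComplexConjugate BigOperators

namespace Summit.RiemannHypothesis.RiemannHypothesis.Theorems.EvenWinsBeyondArch

open Literature.NumberTheory.LFunctions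
open Summit.RiemannHypothesis.RiemannHypothesis.Theorems.OddSector (weilDirichletEnergy₂ weilPoleForm₂)

/-! ## Pointwise algebra: the real quadratic form of `Re(r_i r̄_j)` is `‖Σ α_i r_i‖²` -/

/-- `Σ_i Σ_j α_i α_j Re(z_i z̄_j) = ‖Σ_i α_i z_i‖²` for real `α`. [folklore] -/
theorem dt_sum_sum_mul_re_eq_norm_sq {k : ℕ} (α : Fin k → ℝ) (z : Fin k → ℂ) :
    ∑ i, ∑ j, α i * α j * (z i * conj (z j)).re = ‖∑ i, (α i : ℂ) * z i‖ ^ 2 := by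
  set w : ℂ := ∑ i, (α i : ℂ) * z i with hw
  have h1 : ‖w‖ ^ 2 = (w * conj w).re := by
    rw [Complex.mul_conj']; norm_cast
  rw [h1, hw, Finset.sum_mul, Complex.re_sum]
  refine Finset.sum_congr rfl fun i _ ↦ ?_
  rw [map_sum, Finset.mul_sum, Complex.re_sum]
  refine Finset.sum_congr rfl fun j _ ↦ ?_
  rw [map_mul, Complex.conj_ofReal]
  have : (α i : ℂ) * z i * ((α j : ℂ) * conj (z j)) = ((α i * α j : ℝ) : ℂ) * (z i * conj (z j)) := by
    push_cast; ring
  rw [this, Complex.re_ofReal_mul]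

/-- **Weighted Cauchy–Schwarz**: `‖Σ_i α_i z_i‖² ≤ (Σ_i α_i² θ_i) · Σ_i ‖z_i‖²/θ_i` for `θ_i > 0`. [folklore] -/
theorem dt_norm_sq_sum_le {k : ℕ} (α : Fin k → ℝ) (z : Fin k → ℂ) (θ : Fin k → ℝ) (hθ : ∀ i, 0 < θ i) :
    ‖∑ i, (α i : ℂ) * z i‖ ^ 2 ≤ (∑ i, α i ^ 2 * θ i) * ∑ i, ‖z i‖ ^ 2 / θ i := by
  have h1 : ‖∑ i, (α i : ℂ) * z i‖ ≤ ∑ i, |α i| * Real.sqrt (θ i) * (‖z i‖ / Real.sqrt (θ i)) := by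
    refine (norm_sum_le _ _).trans (Finset.sum_le_sum fun i _ ↦ ?_)
    have hs : 0 < Real.sqrt (θ i) := Real.sqrt_pos.2 (hθ i)
    rw [norm_mul, Complex.norm_real, Real.norm_eq_abs, mul_assoc, mul_div_cancel₀ _ hs.ne']
  have h2 := Finset.sum_mul_sq_le_sq_mul_sq Finset.univ (fun i ↦ |α i| * Real.sqrt (θ i))
    (fun i ↦ ‖z i‖ / Real.sqrt (θ i))
  have h3 : ∑ i, (|α i| * Real.sqrt (θ i)) ^ 2 = ∑ i, α i ^ 2 * θ i :=
    Finset.sum_congr rfl fun i _ ↦ by rw [mul_pow, sq_abs, Real.sq_sqrt (hθ i).le]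
  have h4 : ∑ i, (‖z i‖ / Real.sqrt (θ i)) ^ 2 = ∑ i, ‖z i‖ ^ 2 / θ i :=
    Finset.sum_congr rfl fun i _ ↦ by rw [div_pow, Real.sq_sqrt (hθ i).le]
  rw [h3, h4] at h2
  have h0 : 0 ≤ ∑ i, |α i| * Real.sqrt (θ i) * (‖z i‖ / Real.sqrt (θ i)) :=
    Finset.sum_nonneg fun i _ ↦ by positivity
  calc ‖∑ i, (α i : ℂ) * z i‖ ^ 2 ≤ (∑ i, |α i| * Real.sqrt (θ i) * (‖z i‖ / Real.sqrt (θ i))) ^ 2 :=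
        pow_le_pow_left₀ (norm_nonneg _) h1 2
    _ ≤ _ := h2

/-! ## The operator inequality `Gram(r) ⪯ (Σ ‖r_i‖²/θ_i) · diag θ` -/

/-- **The residual Gram form is dominated by a weighted diagonal**: for `r_i ∈ L²` and `θ_i > 0`,
`Σ_i Σ_j α_i α_j Re⟨r_i, r_j⟩ ≤ (Σ_i α_i² θ_i) · Σ_i ‖r_i‖²₂/θ_i`.
[cite: GoerischHaunhorst1985, §2 (bounds needing only the norms ‖(A−ρ)v_i‖)] -/
theorem dt_gram_quadForm_le {k : ℕ} (r : Fin k → ℝ → ℂ) (hr : ∀ i, MemLp (r i) 2) (θ : Fin k → ℝ)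
    (hθ : ∀ i, 0 < θ i) (α : Fin k → ℝ) :
    ∑ i, ∑ j, α i * α j * ∫ x, (r i x * conj (r j x)).re ≤
      (∑ i, α i ^ 2 * θ i) * ∑ i, (∫ x, ‖r i x‖ ^ 2) / θ i := by
  have hint : ∀ i j, Integrable fun x ↦ (r i x * conj (r j x)).re := fun i j ↦
    dt_integrable_mul_conj_re (hr i) (hr j)
  have hsq : ∀ i, Integrable fun x ↦ ‖r i x‖ ^ 2 := fun i ↦
    (memLp_two_iff_integrable_sq_norm (hr i).1).1 (hr i)
  -- pull the double sum inside the integral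
  have hlhs : ∑ i, ∑ j, α i * α j * ∫ x, (r i x * conj (r j x)).re =
      ∫ x, ∑ i, ∑ j, α i * α j * (r i x * conj (r j x)).re := by
    rw [integral_finsetSum _ fun i _ ↦ integrable_finsetSum _ fun j _ ↦ (hint i j).const_mul _]
    refine Finset.sum_congr rfl fun i _ ↦ ?_
    rw [integral_finsetSum _ fun j _ ↦ (hint i j).const_mul _]
    refine Finset.sum_congr rfl fun j _ ↦ ?_
    rw [integral_const_mul]
  have hrhs : (∑ i, α i ^ 2 * θ i) * ∑ i, (∫ x, ‖r i x‖ ^ 2) / θ i =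
      ∫ x, (∑ i, α i ^ 2 * θ i) * ∑ i, ‖r i x‖ ^ 2 / θ i := by
    rw [integral_const_mul, integral_finsetSum _ fun i _ ↦ (hsq i).div_const _]
    congr 1
    refine Finset.sum_congr rfl fun i _ ↦ ?_
    rw [integral_div]
  rw [hlhs, hrhs]
  refine integral_mono (integrable_finsetSum _ fun i _ ↦ integrable_finsetSum _ fun j _ ↦
    (hint i j).const_mul _) ((integrable_finsetSum _ fun i _ ↦ (hsq i).div_const _).const_mul _) fun x ↦ ?_
  dsimp only
  rw [dt_sum_sum_mul_re_eq_norm_sq]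
  exact dt_norm_sq_sum_le α (fun i ↦ r i x) θ hθ

/-- **The sigma criterion** (diagonal-only PSD test).  If `s_i ≥ ‖r_i‖²₂`, `θ_i > 0`, `Σ_i s_i/θ_i ≤ τ` and the matrix
`N − τ·diag(θ)` is positive semidefinite, then so is `N − Gram(r)`. [cite: GoerischHaunhorst1985, §2] -/
theorem dt_psd_of_sigma {k : ℕ} (N : Fin k → Fin k → ℝ) (r : Fin k → ℝ → ℂ) (hr : ∀ i, MemLp (r i) 2)
    (s θ : Fin k → ℝ) (hθ : ∀ i, 0 < θ i) (hs : ∀ i, ∫ x, ‖r i x‖ ^ 2 ≤ s i) {τ : ℝ}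
    (hτ : ∑ i, s i / θ i ≤ τ)
    (hN : ∀ α : Fin k → ℝ, 0 ≤ ∑ i, ∑ j, α i * α j * (N i j - if i = j then τ * θ i else 0))
    (α : Fin k → ℝ) :
    0 ≤ ∑ i, ∑ j, α i * α j * (N i j - ∫ x, (r i x * conj (r j x)).re) := by
  have hw : 0 ≤ ∑ i, α i ^ 2 * θ i := Finset.sum_nonneg fun i _ ↦ mul_nonneg (sq_nonneg _) (hθ i).le
  have hG := dt_gram_quadForm_le r hr θ hθ α
  have hS : ∑ i, (∫ x, ‖r i x‖ ^ 2) / θ i ≤ τ :=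
    (Finset.sum_le_sum fun i _ ↦ div_le_div_of_nonneg_right (hs i) (hθ i).le).trans hτ
  have hdiag : ∑ i, ∑ j, α i * α j * (if i = j then τ * θ i else 0) = τ * ∑ i, α i ^ 2 * θ i := by
    rw [Finset.mul_sum]
    refine Finset.sum_congr rfl fun i _ ↦ ?_
    simp_rw [mul_ite, mul_zero]
    rw [Finset.sum_ite_eq Finset.univ i, if_pos (Finset.mem_univ i)]
    ring
  have hsplit : ∑ i, ∑ j, α i * α j * (N i j - ∫ x, (r i x * conj (r j x)).re) =
      (∑ i, ∑ j, α i * α j * (N i j - if i = j then τ * θ i else 0)) + τ * (∑ i, α i ^ 2 * θ i) -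
        ∑ i, ∑ j, α i * α j * ∫ x, (r i x * conj (r j x)).re := by
    rw [← hdiag, ← Finset.sum_add_distrib, ← Finset.sum_sub_distrib]
    refine Finset.sum_congr rfl fun i _ ↦ ?_
    rw [← Finset.sum_add_distrib, ← Finset.sum_sub_distrib]
    refine Finset.sum_congr rfl fun j _ ↦ ?_
    ring
  rw [hsplit]
  nlinarith [hN α, mul_le_mul_of_nonneg_left hS hw]

/-! ## The window-image residuals are square integrable -/

/-- The residual `F_i − Σ_l W_il v_l` of the explicit window image of a `C²` × indicator trial vector is in `L²`. -/
theorem dt_residual_memLp {c : ℝ} (hc : 0 < c) {k : ℕ} (g : Fin k → ℝ → ℝ) (hg : ∀ i, ContDiff ℝ 2 (g i))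
    (v F : Fin k → ℝ → ℂ) (hv : ∀ i x, v i x = (((Icc (-c) c).indicator (g i) x : ℝ) : ℂ))
    (hF : ∀ i y, F i y = (Icc (-c) c).indicator (fun y ↦
        2 * (∫ x, v i x * (Real.cosh (x / 2) : ℂ)) * (Real.cosh (y / 2) : ℂ) -
          2 * (∫ x, v i x * (Real.sinh (x / 2) : ℂ)) * (Real.sinh (y / 2) : ℂ) +
        (∑ n ∈ weilPrimeIndex c, (((ArithmeticFunction.vonMangoldt n : ℝ) / Real.sqrt n : ℝ) : ℂ) *
          (2 * v i y - v i (y - Real.log n) - v i (y + Real.log n))) +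
        ∫ t in Ioi 0, (weilArchDensity t : ℂ) * (2 * v i y - v i (y - t) - v i (y + t))) y -
      (weilMarkovConstant c : ℂ) * v i y)
    (W : Fin k → Fin k → ℝ) (i : Fin k) : MemLp (F i - ∑ l, W i l • v l) 2 := by
  have hveq : ∀ i, v i = fun x ↦ (((Icc (-c) c).indicator (g i) x : ℝ) : ℂ) := fun i ↦ funext (hv i)
  have hvm : ∀ i, MemLp (v i) 2 := fun i ↦ by
    rw [hveq i]; exact (dt_indicator_mul_mem_formDomain hc ((hg i).of_le (by norm_num))).1
  have hFm : MemLp (F i) 2 := by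
    obtain ⟨m, hm, _, hHm⟩ := dt_exists_majorant_of_contDiff hc (hg i) (hv i)
    exact dt_windowImage_memLp (hvm i) hm hHm (hF i)
  exact hFm.sub (memLp_finsetSum' _ fun l _ ↦ (hvm l).const_smul _)

/-! ## The deflated Temple bound from Ritz data and the sigma criterion -/

/-- **`λ ≤ ε_ev(c)` from even `C²` × indicator Ritz data, the complement certificate, and the SIGMA CRITERION**:
the hypothesis `hPSD` of `dt_weilEvenGroundEnergy_ge_of_ritz` is replaced by norm bounds `‖F_i − Σ_l W_il v_l‖²₂ ≤ s_i`,
weights `θ_i > 0`, a budget `Σ s_i/θ_i ≤ τ`, and the positive semidefiniteness of `(β−λ)(A − λG) − τ·diag(θ)`.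
[cite: GoerischHaunhorst1985, §2] [cite: WeinsteinStenger1972, Ch. 5 §9 eq. (2)] -/
theorem dt_weilEvenGroundEnergy_ge_of_ritz_sigma {c : ℝ} (hc : 0 < c) {k : ℕ}
    (g : Fin k → ℝ → ℝ) (hg : ∀ i, ContDiff ℝ 2 (g i)) (hge : ∀ i x, g i (-x) = g i x)
    (v F : Fin k → ℝ → ℂ) (hv : ∀ i x, v i x = (((Icc (-c) c).indicator (g i) x : ℝ) : ℂ))
    (hF : ∀ i y, F i y = (Icc (-c) c).indicator (fun y ↦
        2 * (∫ x, v i x * (Real.cosh (x / 2) : ℂ)) * (Real.cosh (y / 2) : ℂ) -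
          2 * (∫ x, v i x * (Real.sinh (x / 2) : ℂ)) * (Real.sinh (y / 2) : ℂ) +
        (∑ n ∈ weilPrimeIndex c, (((ArithmeticFunction.vonMangoldt n : ℝ) / Real.sqrt n : ℝ) : ℂ) *
          (2 * v i y - v i (y - Real.log n) - v i (y + Real.log n))) +
        ∫ t in Ioi 0, (weilArchDensity t : ℂ) * (2 * v i y - v i (y - t) - v i (y + t))) y -
      (weilMarkovConstant c : ℂ) * v i y)
    (W : Fin k → Fin k → ℝ) (μ : Fin k → ℝ) {β lam : ℝ} (hlam : lam < β) (hμ : ∀ i, 0 ≤ μ i)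
    (hcert : ∀ φ : ℝ → ℂ, IsWeilTest φ → tsupport φ ⊆ Icc (-c) c → (∀ x, φ (-x) = φ x) →
      β * ∫ x, ‖φ x‖ ^ 2 ≤ (weilQuadratic φ).re + ∑ i, μ i * ‖∫ x, φ x * conj (v i x)‖ ^ 2)
    (s θ : Fin k → ℝ) (hθ : ∀ i, 0 < θ i) (hs : ∀ i, ∫ x, ‖(F i - ∑ l, W i l • v l) x‖ ^ 2 ≤ s i)
    {τ : ℝ} (hτ : ∑ i, s i / θ i ≤ τ)
    (hN : ∀ α : Fin k → ℝ, 0 ≤ ∑ i, ∑ j, α i * α j *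
      ((β - lam) * ((weilPoleForm₂ (v i) (v j) + weilDirichletEnergy₂ c (v i) (v j) -
          weilMarkovConstant c * ∫ x, (v i x * conj (v j x)).re) - lam * ∫ x, (v i x * conj (v j x)).re) -
        if i = j then τ * θ i else 0)) :
    lam ≤ weilEvenGroundEnergy c :=
  dt_weilEvenGroundEnergy_ge_of_ritz hc g hg hge v F hv hF W μ hlam hμ hcert
    (dt_psd_of_sigma _ (fun i ↦ F i - ∑ l, W i l • v l) (dt_residual_memLp hc g hg v F hv hF W) s θ hθ hs hτ hN)

/-- **`λ ≤ ε_od(c)` from odd `C²` × indicator Ritz data, the complement certificate, and the SIGMA CRITERION** — the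
parity-ladder L-side with `k` norm bounds in place of the residual Gram matrix.
[cite: GoerischHaunhorst1985, §2] [cite: WeinsteinStenger1972, Ch. 5 §9 eq. (2)] -/
theorem dt_weilOddGroundEnergy_ge_of_ritz_sigma {c : ℝ} (hc : 0 < c) {k : ℕ}
    (g : Fin k → ℝ → ℝ) (hg : ∀ i, ContDiff ℝ 2 (g i)) (hgo : ∀ i x, g i (-x) = -g i x)
    (v F : Fin k → ℝ → ℂ) (hv : ∀ i x, v i x = (((Icc (-c) c).indicator (g i) x : ℝ) : ℂ))
    (hF : ∀ i y, F i y = (Icc (-c) c).indicator (fun y ↦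
        2 * (∫ x, v i x * (Real.cosh (x / 2) : ℂ)) * (Real.cosh (y / 2) : ℂ) -
          2 * (∫ x, v i x * (Real.sinh (x / 2) : ℂ)) * (Real.sinh (y / 2) : ℂ) +
        (∑ n ∈ weilPrimeIndex c, (((ArithmeticFunction.vonMangoldt n : ℝ) / Real.sqrt n : ℝ) : ℂ) *
          (2 * v i y - v i (y - Real.log n) - v i (y + Real.log n))) +
        ∫ t in Ioi 0, (weilArchDensity t : ℂ) * (2 * v i y - v i (y - t) - v i (y + t))) y -
      (weilMarkovConstant c : ℂ) * v i y)
    (W : Fin k → Fin k → ℝ) (μ : Fin k → ℝ) {β lam : ℝ} (hlam : lam < β) (hμ : ∀ i, 0 ≤ μ i)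
    (hcert : ∀ φ : ℝ → ℂ, IsWeilTest φ → tsupport φ ⊆ Icc (-c) c → (∀ x, φ (-x) = -φ x) →
      β * ∫ x, ‖φ x‖ ^ 2 ≤ (weilQuadratic φ).re + ∑ i, μ i * ‖∫ x, φ x * conj (v i x)‖ ^ 2)
    (s θ : Fin k → ℝ) (hθ : ∀ i, 0 < θ i) (hs : ∀ i, ∫ x, ‖(F i - ∑ l, W i l • v l) x‖ ^ 2 ≤ s i)
    {τ : ℝ} (hτ : ∑ i, s i / θ i ≤ τ)
    (hN : ∀ α : Fin k → ℝ, 0 ≤ ∑ i, ∑ j, α i * α j *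
      ((β - lam) * ((weilPoleForm₂ (v i) (v j) + weilDirichletEnergy₂ c (v i) (v j) -
          weilMarkovConstant c * ∫ x, (v i x * conj (v j x)).re) - lam * ∫ x, (v i x * conj (v j x)).re) -
        if i = j then τ * θ i else 0)) :
    lam ≤ weilOddGroundEnergy c :=
  dt_weilOddGroundEnergy_ge_of_ritz hc g hg hgo v F hv hF W μ hlam hμ hcert
    (dt_psd_of_sigma _ (fun i ↦ F i - ∑ l, W i l • v l) (dt_residual_memLp hc g hg v F hv hF W) s θ hθ hs hτ hN)

/-! ## From a CHECKED rank-one certificate (`b ≤ log 2`) and the sigma criterion -/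

/-- **`λ ≤ ε_ev(b)` from a checked EVEN rank-one moment certificate and the sigma criterion**: as
`dt_weilEvenGroundEnergy_ge_of_checkR₁`, with `hPSD` replaced by `k` residual norm bounds `s_i`, weights `θ_i > 0`, the budget
`Σ s_i/θ_i ≤ τ`, and `(β−λ)(A − λG) − τ·diag θ ⪰ 0` (A-layer data only).
[cite: Yoshida1992, Thm 1 (moment certificates)] [cite: GoerischHaunhorst1985, §2] -/
theorem dt_weilEvenGroundEnergy_ge_of_checkR₁_sigma (cert : WeilCert23) {β : ℚ} {R : List (ℚ × ℕ × List ℚ)}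
    (hcheck : cert.checkR₁ β R 0 = true) (hμ : ∀ i : Fin R.length, 0 ≤ (R.get i).1)
    (hRp : ∀ i : Fin R.length, (R.get i).2.1 % 2 = 0) (hb0 : 0 < (cert.b : ℝ)) (hb2 : (cert.b : ℝ) ≤ Real.log 2)
    (g : Fin R.length → ℝ → ℝ)
    (hg : ∀ i x, g i x = ∑ k ∈ range (cert.base.N + 1), (maskV (R.get i) k : ℝ) * (x / cert.base.a0) ^ k)
    (v F : Fin R.length → ℝ → ℂ) (hv : ∀ i x, v i x = (((Icc (-(cert.b : ℝ)) cert.b).indicator (g i) x : ℝ) : ℂ))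
    (hF : ∀ i y, F i y = (Icc (-(cert.b : ℝ)) cert.b).indicator (fun y ↦
        2 * (∫ x, v i x * (Real.cosh (x / 2) : ℂ)) * (Real.cosh (y / 2) : ℂ) -
          2 * (∫ x, v i x * (Real.sinh (x / 2) : ℂ)) * (Real.sinh (y / 2) : ℂ) +
        (∑ n ∈ weilPrimeIndex (cert.b : ℝ), (((ArithmeticFunction.vonMangoldt n : ℝ) / Real.sqrt n : ℝ) : ℂ) *
          (2 * v i y - v i (y - Real.log n) - v i (y + Real.log n))) +
        ∫ t in Ioi 0, (weilArchDensity t : ℂ) * (2 * v i y - v i (y - t) - v i (y + t))) y -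
      (weilMarkovConstant (cert.b : ℝ) : ℂ) * v i y)
    (W : Fin R.length → Fin R.length → ℝ) {lam : ℝ} (hlam : lam < (β : ℝ))
    (s θ : Fin R.length → ℝ) (hθ : ∀ i, 0 < θ i) (hs : ∀ i, ∫ x, ‖(F i - ∑ l, W i l • v l) x‖ ^ 2 ≤ s i)
    {τ : ℝ} (hτ : ∑ i, s i / θ i ≤ τ)
    (hN : ∀ α : Fin R.length → ℝ, 0 ≤ ∑ i, ∑ j, α i * α j *
      (((β : ℝ) - lam) * ((weilPoleForm₂ (v i) (v j) + weilDirichletEnergy₂ (cert.b : ℝ) (v i) (v j) -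
          weilMarkovConstant (cert.b : ℝ) * ∫ x, (v i x * conj (v j x)).re) - lam * ∫ x, (v i x * conj (v j x)).re) -
        if i = j then τ * θ i else 0)) :
    lam ≤ weilEvenGroundEnergy (cert.b : ℝ) := by
  have hgC : ∀ i, ContDiff ℝ 2 (g i) := fun i ↦ by
    rw [show g i = fun x ↦ ∑ k ∈ range (cert.base.N + 1), (maskV (R.get i) k : ℝ) * (x / cert.base.a0) ^ k
      from funext (hg i)]
    exact ContDiff.sum fun k _ ↦ contDiff_const.mul ((contDiff_id.div_const _).pow k)
  exact dt_weilEvenGroundEnergy_ge_of_checkR₁ cert hcheck hμ hRp hb0 hb2 g hg v F hv hF W hlam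
    (dt_psd_of_sigma _ (fun i ↦ F i - ∑ l, W i l • v l) (dt_residual_memLp hb0 g hgC v F hv hF W) s θ hθ hs hτ hN)

/-- **`λ ≤ ε_od(b)` from a checked ODD rank-one moment certificate and the sigma criterion** — the parity-ladder L-side
in the form the R-layer of this programme delivers (`k` validated norm bounds `s_i`).
[cite: Yoshida1992, Thm 1 (moment certificates)] [cite: GoerischHaunhorst1985, §2] -/
theorem dt_weilOddGroundEnergy_ge_of_checkR₁_sigma (cert : WeilCert23) {β : ℚ} {R : List (ℚ × ℕ × List ℚ)}
    (hcheck : cert.checkR₁ β R 1 = true) (hμ : ∀ i : Fin R.length, 0 ≤ (R.get i).1)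
    (hRp : ∀ i : Fin R.length, (R.get i).2.1 % 2 = 1) (hb0 : 0 < (cert.b : ℝ)) (hb2 : (cert.b : ℝ) ≤ Real.log 2)
    (g : Fin R.length → ℝ → ℝ)
    (hg : ∀ i x, g i x = ∑ k ∈ range (cert.base.N + 1), (maskV (R.get i) k : ℝ) * (x / cert.base.a0) ^ k)
    (v F : Fin R.length → ℝ → ℂ) (hv : ∀ i x, v i x = (((Icc (-(cert.b : ℝ)) cert.b).indicator (g i) x : ℝ) : ℂ))
    (hF : ∀ i y, F i y = (Icc (-(cert.b : ℝ)) cert.b).indicator (fun y ↦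
        2 * (∫ x, v i x * (Real.cosh (x / 2) : ℂ)) * (Real.cosh (y / 2) : ℂ) -
          2 * (∫ x, v i x * (Real.sinh (x / 2) : ℂ)) * (Real.sinh (y / 2) : ℂ) +
        (∑ n ∈ weilPrimeIndex (cert.b : ℝ), (((ArithmeticFunction.vonMangoldt n : ℝ) / Real.sqrt n : ℝ) : ℂ) *
          (2 * v i y - v i (y - Real.log n) - v i (y + Real.log n))) +
        ∫ t in Ioi 0, (weilArchDensity t : ℂ) * (2 * v i y - v i (y - t) - v i (y + t))) y -
      (weilMarkovConstant (cert.b : ℝ) : ℂ) * v i y)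
    (W : Fin R.length → Fin R.length → ℝ) {lam : ℝ} (hlam : lam < (β : ℝ))
    (s θ : Fin R.length → ℝ) (hθ : ∀ i, 0 < θ i) (hs : ∀ i, ∫ x, ‖(F i - ∑ l, W i l • v l) x‖ ^ 2 ≤ s i)
    {τ : ℝ} (hτ : ∑ i, s i / θ i ≤ τ)
    (hN : ∀ α : Fin R.length → ℝ, 0 ≤ ∑ i, ∑ j, α i * α j *
      (((β : ℝ) - lam) * ((weilPoleForm₂ (v i) (v j) + weilDirichletEnergy₂ (cert.b : ℝ) (v i) (v j) -
          weilMarkovConstant (cert.b : ℝ) * ∫ x, (v i x * conj (v j x)).re) - lam * ∫ x, (v i x * conj (v j x)).re) -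
        if i = j then τ * θ i else 0)) :
    lam ≤ weilOddGroundEnergy (cert.b : ℝ) := by
  have hgC : ∀ i, ContDiff ℝ 2 (g i) := fun i ↦ by
    rw [show g i = fun x ↦ ∑ k ∈ range (cert.base.N + 1), (maskV (R.get i) k : ℝ) * (x / cert.base.a0) ^ k
      from funext (hg i)]
    exact ContDiff.sum fun k _ ↦ contDiff_const.mul ((contDiff_id.div_const _).pow k)
  exact dt_weilOddGroundEnergy_ge_of_checkR₁ cert hcheck hμ hRp hb0 hb2 g hg v F hv hF W hlam
    (dt_psd_of_sigma _ (fun i ↦ F i - ∑ l, W i l • v l) (dt_residual_memLp hb0 g hgC v F hv hF W) s θ hθ hs hτ hN)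

end Summit.RiemannHypothesis.RiemannHypothesis.Theorems.EvenWinsBeyondArch

end
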